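import Mathlib
import HarnessLib
import Summits.HubbardSuperconductivity.HubbardSuperconductivity.Theorems.KLProgrammeKLRegimeEngineTowerImportWt

/-!
# Route `KLProgramme` — crux K3 ENGINE (stmt-HubbardSuperconductivity-20437 `KLRegimeEngineV17F2`), register item «(b)-WT4» (pen (R355)): THE WEIGHTED IMPORT ROWS AT
# THE ARRAY LEVEL — the weighted tower's two-, four- and six-leg input sizes `klTowerMeasWtAt … d k j m` and the `KernelNormsWt4` carrier `klWtPinnedSum … j 4/6`
# from WEIGHTED PLAIN LINES (cell gate-hubbard-kl, seat hubbard-kl-k3c2-p3 g15, row «sector-counting import», located «(ℓ)-IMPORT-WT» (W4) arrays)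

`…EngineTowerImportWt` (this seat) bounds the weighted one-anchor carrier `klWtPinnedSumAt … K_n J j (m+1) T q (y, ℓ)` of any momentum-conserving `T` by
(one-anchor count) × `CW^{m+1}` × (weighted plain pinned line), counts and transfer discharged on the flow frame.  Here the two array-level consumers are served:

* §1 **`klTowerMeasWtAt_two/_four/_six_le_of_wplain_flow_all (d R c″)`** — the weighted tower's INPUT sizes of block `k` (`T = 𝒱_{dk}[K_n]`, family `F_{dk−1}`,
  `1 ≤ dk−1 ≤ n`, any rate `j ≥ dk−1`): `klTowerMeasWtAt L M β U μ K_n d k j 2/4/6 ≤ klThinCount2C·CW²·Sʷ / klThinCountC·sectorCount(dk−1)·CW⁴·Sʷ /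
  klThinCount6C·|SectorLeg (sectorCount (dk−1))|⁴·CW⁶·Sʷ` (sup over the pins of `…TowerImportWt` §3);
* §2 **`klWtPinnedSum_four/_six_le_of_wplain_flow_all (R c″)`** — the `KernelNormsWt4 … j` carrier itself (`T = 𝒱_j[K_n]` at its own family and rate, `1 ≤ j ≤ n`):
  `klWtPinnedSum L M β U μ K_n j 4 q w ≤ klThinCountC·sectorCount j·CW⁴·Sʷ`, `klWtPinnedSum … j 6 q w ≤ klThinCount6C·|SectorLeg (sectorCount j)|⁴·CW⁶·Sʷ` — the counts'
  `sectorCount j = 2·2^j` and `|SectorLeg|⁴ = 4096·2^{4j}` are the `2^{(3m/2−5)j}` of `klWtBudget … j 4/6`, so the Wt4 degree-4/6 clauses hold as soon as E1's weighted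
  plain lines carry `CE²·ε_j / CE³·ε_j²` (M-free).
Everything is proved; no definitions; the weighted plain lines stay hypotheses (E1); nothing asserts (ℓ), `KernelNormsWt4`, any stub, K3 or superconductivity.
References: BGM 2006 §2.7 (2.71a), §2.8 (2.76)–(2.77), (2.96) [cite: BenfattoGiulianiMastropietro2006].
-/

noncomputable section

namespace Summit.HubbardSuperconductivity.HubbardSuperconductivity.Theorems.EngineV8

set_option linter.dupNamespace false -- summit = problem name (single-conjunct summit), D-0017

open Classical
open Real Finset Literature.MathematicalPhysics.QuantumLattice Literature.Probability.LatticeModels GrassmannAlgebra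
open Literature.MathematicalPhysics.QuantumLattice.FermiRG
open Summit.HubbardSuperconductivity.HubbardSuperconductivity.Theorems.KLProgrammeLegKernels
open Summit.HubbardSuperconductivity.HubbardSuperconductivity.Theorems.KLRegimeSplit
open Summit.HubbardSuperconductivity.HubbardSuperconductivity.Theorems.TorusFourierL2
open Summit.HubbardSuperconductivity.HubbardSuperconductivity.Theorems.DispersionFlow
open Summit.HubbardSuperconductivity.HubbardSuperconductivity.Theorems.KLRegimeWick

/-! ## §1 The weighted tower's input sizes -/

/-- **THE WEIGHTED TWO-LEG INPUT SIZE OF BLOCK `k` FROM THE WEIGHTED PLAIN LINE** (`T = 𝒱_{dk}[K_n]` at `F_{dk−1}`, `1 ≤ dk − 1 ≤ n`, rate `j ≥ dk − 1`):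
`∃ CW > 0` such that, under the flow-frame binders and the count doors, `klTowerMeasWtAt L M β U μ K_n d k j 2 ≤ N_c·(CW^2·Sʷ)` with `N_c` the landed one-anchor count,
whenever every `klScaleWt_j`-weighted PLAIN two-leg pinned sum of `𝒱_{dk}[K_n]` (any leg, spin/charge string, pin) is `≤ Sʷ`.
[cite: BenfattoGiulianiMastropietro2006, §2.7 (2.71a), §2.8 (2.76)-(2.77), (2.96)] -/
theorem klTowerMeasWtAt_two_le_of_wplain_flow_all (d : ℕ) (R : RenConsts) (c'' : ℝ) (hc'' : 0 ≤ c'') :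
    ∃ CW : ℝ, 0 < CW ∧
      ∀ (G : GeoConsts) (P : SplitConsts) (Q : EngConsts) (cc : ℝ), R.WF2 → 0 < cc → cc ≤ klEngC₃6 P R → cc ≤ klThinCount2C₃ R →
      ∀ μ ∈ klWindowC, ∀ U : ℝ, 0 < U → U ≤ min (klEngU₀3 P R cc) (1 / (R.Gfr 3 + 1)) → U ≤ klThinCount2U₀ R → c'' * U ≤ 1 →
      ∀ β : ℝ, klBetaMin ≤ β → β ≤ Real.exp (cc / U ^ 2) →
      ∀ (L M : ℕ) [NeZero L] [NeZero M], klEngL₃ β U ≤ L → klEngM₃ β U L ≤ M →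
      ∀ n : ℕ, 1 ≤ n → n ≤ nScales β + 1 → IsKLRegime U cc (-(n : ℤ)) → HistP klPredsV17F2 L M G P Q R β U μ 0 n →
        (∀ m', 1 ≤ m' → m' < n → FlowPieceOscAt L M c'' β U μ m') →
        ∀ k j : ℕ, 1 ≤ d * k - 1 → d * k - 1 ≤ n → d * k - 1 ≤ j → ∀ Sw : ℝ, 0 ≤ Sw →
        (∀ (q : Fin 2) (τ' : Fin 2 → SectorLeg 1) (y' : SpaceTimeIdx L M),
          imagTimeWeight β M ^ 1 * ∑ x' ∈ univ.filter (fun x' : Fin 2 → SpaceTimeIdx L M => x' q = y'),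
            klScaleWt L M β j ((univ.image x').image (fun x : SpaceTimeIdx L M => (((((2 * (x.1 : ℕ) : ℕ)) : ZMod (2 * (2 * M)))), x.2))) *
              ‖sectorisedKernel L M β (trivialMultiplier L M) (klTowerInput L M β U μ (klFlowFrameU L M β U μ n) d k) 2 τ' x'‖ ≤ Sw) →
        klTowerMeasWtAt L M β U μ (klFlowFrameU L M β U μ n) d k j 2 ≤ klThinCount2C * (CW ^ 2 * Sw) := by
  obtain ⟨CW, hCW, h⟩ := klWtPinnedSumAt_two_le_of_wplain_flow_all R c'' hc''
  refine ⟨CW, hCW, ?_⟩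
  intro G P Q cc hR2 hcc hcc6 hccT μ hμ U hU hUle hUT hcU β hβmin hβc L M _ _ hL3 hM3 n hn1 hnN hreg hhist hosc k j hk1 hkn hkj Sw hSw hplain
  have hC := klThinCount2C_pos
  have hT : ∀ (m' : ℕ) (X : Fin m' → HubbardFieldIdx L M), ∑ i, signedMomentum L (X i).2 (X i).1.1.2 ≠ 0 →
      kernel ℂ (klTowerInput L M β U μ (klFlowFrameU L M β U μ n) d k) m' X = 0 :=
    fun m' X hX => klEffectiveAction_momentumConserving β U μ (klFlowFrameU L M β U μ n) klE0 (d * k) m' X hX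
  unfold klTowerMeasWtAt
  refine Real.iSup_le (fun qw => ?_) (by positivity)
  obtain ⟨q, y, ℓ⟩ := qw
  exact h G P Q cc hR2 hcc hcc6 hccT μ hμ U hU hUle hUT hcU β hβmin hβc L M hL3 hM3 n hn1 hnN hreg hhist hosc (d * k - 1) j hk1 hkn hkj
    (klTowerInput L M β U μ (klFlowFrameU L M β U μ n) d k) hT q y ℓ Sw hSw (hplain q)

/-- **THE WEIGHTED FOUR-LEG INPUT SIZE OF BLOCK `k` FROM THE WEIGHTED PLAIN LINE** (`T = 𝒱_{dk}[K_n]` at `F_{dk−1}`, `1 ≤ dk − 1 ≤ n`, rate `j ≥ dk − 1`):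
`∃ CW > 0` such that, under the flow-frame binders and the count doors, `klTowerMeasWtAt L M β U μ K_n d k j 4 ≤ N_c·(CW^4·Sʷ)` with `N_c` the landed one-anchor count,
whenever every `klScaleWt_j`-weighted PLAIN four-leg pinned sum of `𝒱_{dk}[K_n]` (any leg, spin/charge string, pin) is `≤ Sʷ`.
[cite: BenfattoGiulianiMastropietro2006, §2.7 (2.71a), §2.8 (2.76)-(2.77), (2.96)] -/
theorem klTowerMeasWtAt_four_le_of_wplain_flow_all (d : ℕ) (R : RenConsts) (c'' : ℝ) (hc'' : 0 ≤ c'') :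
    ∃ CW : ℝ, 0 < CW ∧
      ∀ (G : GeoConsts) (P : SplitConsts) (Q : EngConsts) (cc : ℝ), R.WF2 → 0 < cc → cc ≤ klEngC₃6 P R → cc ≤ klThinCountC₃ R →
      ∀ μ ∈ klWindowC, ∀ U : ℝ, 0 < U → U ≤ min (klEngU₀3 P R cc) (1 / (R.Gfr 3 + 1)) → U ≤ klThinCountU₀ R → c'' * U ≤ 1 →
      ∀ β : ℝ, klBetaMin ≤ β → β ≤ Real.exp (cc / U ^ 2) →
      ∀ (L M : ℕ) [NeZero L] [NeZero M], klEngL₃ β U ≤ L → klEngM₃ β U L ≤ M →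
      ∀ n : ℕ, 1 ≤ n → n ≤ nScales β + 1 → IsKLRegime U cc (-(n : ℤ)) → HistP klPredsV17F2 L M G P Q R β U μ 0 n →
        (∀ m', 1 ≤ m' → m' < n → FlowPieceOscAt L M c'' β U μ m') →
        ∀ k j : ℕ, 1 ≤ d * k - 1 → d * k - 1 ≤ n → d * k - 1 ≤ j → ∀ Sw : ℝ, 0 ≤ Sw →
        (∀ (q : Fin 4) (τ' : Fin 4 → SectorLeg 1) (y' : SpaceTimeIdx L M),
          imagTimeWeight β M ^ 3 * ∑ x' ∈ univ.filter (fun x' : Fin 4 → SpaceTimeIdx L M => x' q = y'),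
            klScaleWt L M β j ((univ.image x').image (fun x : SpaceTimeIdx L M => (((((2 * (x.1 : ℕ) : ℕ)) : ZMod (2 * (2 * M)))), x.2))) *
              ‖sectorisedKernel L M β (trivialMultiplier L M) (klTowerInput L M β U μ (klFlowFrameU L M β U μ n) d k) 4 τ' x'‖ ≤ Sw) →
        klTowerMeasWtAt L M β U μ (klFlowFrameU L M β U μ n) d k j 4 ≤ (klThinCountC * sectorCount (d * k - 1)) * (CW ^ 4 * Sw) := by
  obtain ⟨CW, hCW, h⟩ := klWtPinnedSumAt_four_le_of_wplain_flow_all R c'' hc''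
  refine ⟨CW, hCW, ?_⟩
  intro G P Q cc hR2 hcc hcc6 hccT μ hμ U hU hUle hUT hcU β hβmin hβc L M _ _ hL3 hM3 n hn1 hnN hreg hhist hosc k j hk1 hkn hkj Sw hSw hplain
  have hC := klThinCountC_pos
  have hT : ∀ (m' : ℕ) (X : Fin m' → HubbardFieldIdx L M), ∑ i, signedMomentum L (X i).2 (X i).1.1.2 ≠ 0 →
      kernel ℂ (klTowerInput L M β U μ (klFlowFrameU L M β U μ n) d k) m' X = 0 :=
    fun m' X hX => klEffectiveAction_momentumConserving β U μ (klFlowFrameU L M β U μ n) klE0 (d * k) m' X hX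
  unfold klTowerMeasWtAt
  refine Real.iSup_le (fun qw => ?_) (by positivity)
  obtain ⟨q, y, ℓ⟩ := qw
  exact h G P Q cc hR2 hcc hcc6 hccT μ hμ U hU hUle hUT hcU β hβmin hβc L M hL3 hM3 n hn1 hnN hreg hhist hosc (d * k - 1) j hk1 hkn hkj
    (klTowerInput L M β U μ (klFlowFrameU L M β U μ n) d k) hT q y ℓ Sw hSw (hplain q)

/-- **THE WEIGHTED SIX-LEG INPUT SIZE OF BLOCK `k` FROM THE WEIGHTED PLAIN LINE** (`T = 𝒱_{dk}[K_n]` at `F_{dk−1}`, `1 ≤ dk − 1 ≤ n`, rate `j ≥ dk − 1`):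
`∃ CW > 0` such that, under the flow-frame binders and the count doors, `klTowerMeasWtAt L M β U μ K_n d k j 6 ≤ N_c·(CW^6·Sʷ)` with `N_c` the landed one-anchor count,
whenever every `klScaleWt_j`-weighted PLAIN six-leg pinned sum of `𝒱_{dk}[K_n]` (any leg, spin/charge string, pin) is `≤ Sʷ`.
[cite: BenfattoGiulianiMastropietro2006, §2.7 (2.71a), §2.8 (2.76)-(2.77), (2.96)] -/
theorem klTowerMeasWtAt_six_le_of_wplain_flow_all (d : ℕ) (R : RenConsts) (c'' : ℝ) (hc'' : 0 ≤ c'') :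
    ∃ CW : ℝ, 0 < CW ∧
      ∀ (G : GeoConsts) (P : SplitConsts) (Q : EngConsts) (cc : ℝ), R.WF2 → 0 < cc → cc ≤ klEngC₃6 P R → cc ≤ klThinCount6C₃ R →
      ∀ μ ∈ klWindowC, ∀ U : ℝ, 0 < U → U ≤ min (klEngU₀3 P R cc) (1 / (R.Gfr 3 + 1)) → U ≤ klThinCount6U₀ R → c'' * U ≤ 1 →
      ∀ β : ℝ, klBetaMin ≤ β → β ≤ Real.exp (cc / U ^ 2) →
      ∀ (L M : ℕ) [NeZero L] [NeZero M], klEngL₃ β U ≤ L → klEngM₃ β U L ≤ M →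
      ∀ n : ℕ, 1 ≤ n → n ≤ nScales β + 1 → IsKLRegime U cc (-(n : ℤ)) → HistP klPredsV17F2 L M G P Q R β U μ 0 n →
        (∀ m', 1 ≤ m' → m' < n → FlowPieceOscAt L M c'' β U μ m') →
        ∀ k j : ℕ, 1 ≤ d * k - 1 → d * k - 1 ≤ n → d * k - 1 ≤ j → ∀ Sw : ℝ, 0 ≤ Sw →
        (∀ (q : Fin 6) (τ' : Fin 6 → SectorLeg 1) (y' : SpaceTimeIdx L M),
          imagTimeWeight β M ^ 5 * ∑ x' ∈ univ.filter (fun x' : Fin 6 → SpaceTimeIdx L M => x' q = y'),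
            klScaleWt L M β j ((univ.image x').image (fun x : SpaceTimeIdx L M => (((((2 * (x.1 : ℕ) : ℕ)) : ZMod (2 * (2 * M)))), x.2))) *
              ‖sectorisedKernel L M β (trivialMultiplier L M) (klTowerInput L M β U μ (klFlowFrameU L M β U μ n) d k) 6 τ' x'‖ ≤ Sw) →
        klTowerMeasWtAt L M β U μ (klFlowFrameU L M β U μ n) d k j 6 ≤ (klThinCount6C * (Fintype.card (SectorLeg (sectorCount (d * k - 1))) : ℝ) ^ 4) * (CW ^ 6 * Sw) := by
  obtain ⟨CW, hCW, h⟩ := klWtPinnedSumAt_six_le_of_wplain_flow_all R c'' hc''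
  refine ⟨CW, hCW, ?_⟩
  intro G P Q cc hR2 hcc hcc6 hccT μ hμ U hU hUle hUT hcU β hβmin hβc L M _ _ hL3 hM3 n hn1 hnN hreg hhist hosc k j hk1 hkn hkj Sw hSw hplain
  have hC := klThinCount6C_pos
  have hT : ∀ (m' : ℕ) (X : Fin m' → HubbardFieldIdx L M), ∑ i, signedMomentum L (X i).2 (X i).1.1.2 ≠ 0 →
      kernel ℂ (klTowerInput L M β U μ (klFlowFrameU L M β U μ n) d k) m' X = 0 :=
    fun m' X hX => klEffectiveAction_momentumConserving β U μ (klFlowFrameU L M β U μ n) klE0 (d * k) m' X hX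
  unfold klTowerMeasWtAt
  refine Real.iSup_le (fun qw => ?_) (by positivity)
  obtain ⟨q, y, ℓ⟩ := qw
  exact h G P Q cc hR2 hcc hcc6 hccT μ hμ U hU hUle hUT hcU β hβmin hβc L M hL3 hM3 n hn1 hnN hreg hhist hosc (d * k - 1) j hk1 hkn hkj
    (klTowerInput L M β U μ (klFlowFrameU L M β U μ n) d k) hT q y ℓ Sw hSw (hplain q)

/-! ## §2 The `KernelNormsWt4` carrier at its own family and rate -/

/-- **THE `KernelNormsWt4` FOUR-LEG CARRIER FROM THE WEIGHTED PLAIN LINE** (`T = 𝒱_j[K_n]` at its own family `F_j` and rate `j`, `1 ≤ j ≤ n`): `∃ CW > 0` such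
that, under the flow-frame binders and the count doors, `klWtPinnedSum L M β U μ K_n j 4 q w ≤ N_c·(CW^4·Sʷ)` whenever every `klScaleWt_j`-weighted PLAIN
four-leg pinned sum of `𝒱_j[K_n]` at leg `q` is `≤ Sʷ`. [cite: BenfattoGiulianiMastropietro2006, §2.7 (2.71a), §2.8 (2.76)-(2.77), (2.96)] -/
theorem klWtPinnedSum_four_le_of_wplain_flow_all (R : RenConsts) (c'' : ℝ) (hc'' : 0 ≤ c'') :
    ∃ CW : ℝ, 0 < CW ∧
      ∀ (G : GeoConsts) (P : SplitConsts) (Q : EngConsts) (cc : ℝ), R.WF2 → 0 < cc → cc ≤ klEngC₃6 P R → cc ≤ klThinCountC₃ R →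
      ∀ μ ∈ klWindowC, ∀ U : ℝ, 0 < U → U ≤ min (klEngU₀3 P R cc) (1 / (R.Gfr 3 + 1)) → U ≤ klThinCountU₀ R → c'' * U ≤ 1 →
      ∀ β : ℝ, klBetaMin ≤ β → β ≤ Real.exp (cc / U ^ 2) →
      ∀ (L M : ℕ) [NeZero L] [NeZero M], klEngL₃ β U ≤ L → klEngM₃ β U L ≤ M →
      ∀ n : ℕ, 1 ≤ n → n ≤ nScales β + 1 → IsKLRegime U cc (-(n : ℤ)) → HistP klPredsV17F2 L M G P Q R β U μ 0 n →
        (∀ m', 1 ≤ m' → m' < n → FlowPieceOscAt L M c'' β U μ m') →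
        ∀ j : ℕ, 1 ≤ j → j ≤ n → ∀ (q : Fin 4) (w : SpaceTimeIdx L M × SectorLeg (sectorCount j)) (Sw : ℝ), 0 ≤ Sw →
        (∀ (τ' : Fin 4 → SectorLeg 1) (y' : SpaceTimeIdx L M),
          imagTimeWeight β M ^ 3 * ∑ x' ∈ univ.filter (fun x' : Fin 4 → SpaceTimeIdx L M => x' q = y'),
            klScaleWt L M β j ((univ.image x').image (fun x : SpaceTimeIdx L M => (((((2 * (x.1 : ℕ) : ℕ)) : ZMod (2 * (2 * M)))), x.2))) *
              ‖sectorisedKernel L M β (trivialMultiplier L M) (klEffectiveAction L M β U μ (klFlowFrameU L M β U μ n) klE0 j) 4 τ' x'‖ ≤ Sw) →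
        klWtPinnedSum L M β U μ (klFlowFrameU L M β U μ n) j 4 q w ≤ (klThinCountC * sectorCount j) * (CW ^ 4 * Sw) := by
  obtain ⟨CW, hCW, h⟩ := klWtPinnedSumAt_four_le_of_wplain_flow_all R c'' hc''
  refine ⟨CW, hCW, ?_⟩
  intro G P Q cc hR2 hcc hcc6 hccT μ hμ U hU hUle hUT hcU β hβmin hβc L M _ _ hL3 hM3 n hn1 hnN hreg hhist hosc j hj1 hjn q w Sw hSw hplain
  have hT : ∀ (m' : ℕ) (X : Fin m' → HubbardFieldIdx L M), ∑ i, signedMomentum L (X i).2 (X i).1.1.2 ≠ 0 →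
      kernel ℂ (klEffectiveAction L M β U μ (klFlowFrameU L M β U μ n) klE0 j) m' X = 0 :=
    fun m' X hX => klEffectiveAction_momentumConserving β U μ (klFlowFrameU L M β U μ n) klE0 j m' X hX
  obtain ⟨y, ℓ⟩ := w
  rw [← klWtPinnedSumOf_klEffectiveAction, ← klWtPinnedSumAt_self]
  exact h G P Q cc hR2 hcc hcc6 hccT μ hμ U hU hUle hUT hcU β hβmin hβc L M hL3 hM3 n hn1 hnN hreg hhist hosc j j hj1 hjn le_rfl
    (klEffectiveAction L M β U μ (klFlowFrameU L M β U μ n) klE0 j) hT q y ℓ Sw hSw hplain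

/-- **THE `KernelNormsWt4` SIX-LEG CARRIER FROM THE WEIGHTED PLAIN LINE** (`T = 𝒱_j[K_n]` at its own family `F_j` and rate `j`, `1 ≤ j ≤ n`): `∃ CW > 0` such
that, under the flow-frame binders and the count doors, `klWtPinnedSum L M β U μ K_n j 6 q w ≤ N_c·(CW^6·Sʷ)` whenever every `klScaleWt_j`-weighted PLAIN
six-leg pinned sum of `𝒱_j[K_n]` at leg `q` is `≤ Sʷ`. [cite: BenfattoGiulianiMastropietro2006, §2.7 (2.71a), §2.8 (2.76)-(2.77), (2.96)] -/
theorem klWtPinnedSum_six_le_of_wplain_flow_all (R : RenConsts) (c'' : ℝ) (hc'' : 0 ≤ c'') :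
    ∃ CW : ℝ, 0 < CW ∧
      ∀ (G : GeoConsts) (P : SplitConsts) (Q : EngConsts) (cc : ℝ), R.WF2 → 0 < cc → cc ≤ klEngC₃6 P R → cc ≤ klThinCount6C₃ R →
      ∀ μ ∈ klWindowC, ∀ U : ℝ, 0 < U → U ≤ min (klEngU₀3 P R cc) (1 / (R.Gfr 3 + 1)) → U ≤ klThinCount6U₀ R → c'' * U ≤ 1 →
      ∀ β : ℝ, klBetaMin ≤ β → β ≤ Real.exp (cc / U ^ 2) →
      ∀ (L M : ℕ) [NeZero L] [NeZero M], klEngL₃ β U ≤ L → klEngM₃ β U L ≤ M →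
      ∀ n : ℕ, 1 ≤ n → n ≤ nScales β + 1 → IsKLRegime U cc (-(n : ℤ)) → HistP klPredsV17F2 L M G P Q R β U μ 0 n →
        (∀ m', 1 ≤ m' → m' < n → FlowPieceOscAt L M c'' β U μ m') →
        ∀ j : ℕ, 1 ≤ j → j ≤ n → ∀ (q : Fin 6) (w : SpaceTimeIdx L M × SectorLeg (sectorCount j)) (Sw : ℝ), 0 ≤ Sw →
        (∀ (τ' : Fin 6 → SectorLeg 1) (y' : SpaceTimeIdx L M),
          imagTimeWeight β M ^ 5 * ∑ x' ∈ univ.filter (fun x' : Fin 6 → SpaceTimeIdx L M => x' q = y'),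
            klScaleWt L M β j ((univ.image x').image (fun x : SpaceTimeIdx L M => (((((2 * (x.1 : ℕ) : ℕ)) : ZMod (2 * (2 * M)))), x.2))) *
              ‖sectorisedKernel L M β (trivialMultiplier L M) (klEffectiveAction L M β U μ (klFlowFrameU L M β U μ n) klE0 j) 6 τ' x'‖ ≤ Sw) →
        klWtPinnedSum L M β U μ (klFlowFrameU L M β U μ n) j 6 q w ≤ (klThinCount6C * (Fintype.card (SectorLeg (sectorCount j)) : ℝ) ^ 4) * (CW ^ 6 * Sw) := by
  obtain ⟨CW, hCW, h⟩ := klWtPinnedSumAt_six_le_of_wplain_flow_all R c'' hc''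
  refine ⟨CW, hCW, ?_⟩
  intro G P Q cc hR2 hcc hcc6 hccT μ hμ U hU hUle hUT hcU β hβmin hβc L M _ _ hL3 hM3 n hn1 hnN hreg hhist hosc j hj1 hjn q w Sw hSw hplain
  have hT : ∀ (m' : ℕ) (X : Fin m' → HubbardFieldIdx L M), ∑ i, signedMomentum L (X i).2 (X i).1.1.2 ≠ 0 →
      kernel ℂ (klEffectiveAction L M β U μ (klFlowFrameU L M β U μ n) klE0 j) m' X = 0 :=
    fun m' X hX => klEffectiveAction_momentumConserving β U μ (klFlowFrameU L M β U μ n) klE0 j m' X hX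
  obtain ⟨y, ℓ⟩ := w
  rw [← klWtPinnedSumOf_klEffectiveAction, ← klWtPinnedSumAt_self]
  exact h G P Q cc hR2 hcc hcc6 hccT μ hμ U hU hUle hUT hcU β hβmin hβc L M hL3 hM3 n hn1 hnN hreg hhist hosc j j hj1 hjn le_rfl
    (klEffectiveAction L M β U μ (klFlowFrameU L M β U μ n) klE0 j) hT q y ℓ Sw hSw hplain

end Summit.HubbardSuperconductivity.HubbardSuperconductivity.Theorems.EngineV8

end
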